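import Summits.AtomisticToContinuum.Crystallization.Theorems.OverbindingBudgetAffineLayerPoissonA

/-!
# «LayerPoisson» (lens-4 g65 leaf (IV): Poisson–Bessel layer-shift insensitivity — dual Bessel expansion of Σ(‖y‖²+c)^{-σ} − Σ(‖y−x‖²+c)^{-σ}, spread bounds, ambient translates of a planar lattice) — part 2 of 2 (sequel of `…OverbindingBudgetAffineLayerPoissonA`)

Split for the 400-line cap by the landing lane (hand-2 g30); the module docstring of part 1 (`…OverbindingBudgetAffineLayerPoissonA`) describes the whole node.  Same namespace; all FQNs unchanged.
0 sorry; standard axioms.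
-/

noncomputable section
open MeasureTheory Set Module
open scoped Real InnerProductSpace

namespace Summit.AtomisticToContinuum.Crystallization.Theorems.OverbindingBudgetAffineFarSmoothSplit

open Literature.Algebra.EuclideanLattices Literature.Analysis.FunctionSpaces

variable {V : Type*} [NormedAddCommGroup V] [InnerProductSpace ℝ V] [FiniteDimensional ℝ V]
  [MeasurableSpace V] [BorelSpace V]
variable (L : Submodule ℤ V) [DiscreteTopology L] [IsZLattice ℝ L]

/-- **The Poisson–Bessel expansion of the registry dependence of a shifted Epstein-type sum**
(incomplete-Bessel / Chowla–Selberg type): for `2σ > n = dim V`, `c > 0`, `x ∈ V`, and with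
`μ = σ − n/2`,
`Σ_{y∈L}(‖y‖²+c)^{−σ} − Σ_{y∈L}(‖y−x‖²+c)^{−σ}
   = (2√πⁿ/(Γ(σ) covol L)) Σ_{w∈L*} (1 − cos 2π⟪x,w⟫) (π‖w‖/√c)^μ K_μ(2π√c‖w‖)`
(unconditional: the dual Bessel family is summable by `summable_rpow_mul_besselKReal`). [folklore] -/
theorem tsum_inv_pow_sub_tsum_inv_pow_shift_eq (σ : ℕ) (hσ : finrank ℝ V < 2 * σ) {c : ℝ}
    (hc : 0 < c) (x : V) :
    (∑' y : L, ((‖(y : V)‖ ^ 2 + c) ^ σ)⁻¹) - ∑' y : L, ((‖(y : V) - x‖ ^ 2 + c) ^ σ)⁻¹ =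
      2 * Real.sqrt π ^ finrank ℝ V / (Real.Gamma σ * ZLattice.covolume L) *
        ∑' w : dualLattice L, (1 - Real.cos (2 * π * ⟪x, (w : V)⟫_ℝ)) *
          ((π * ‖(w : V)‖ / Real.sqrt c) ^ ((σ : ℝ) - finrank ℝ V / 2) *
            besselKReal ((σ : ℝ) - finrank ℝ V / 2) (2 * π * Real.sqrt c * ‖(w : V)‖)) := by
  -- abbreviations
  set n : ℕ := finrank ℝ V with hn
  set μ : ℝ := (σ : ℝ) - (n : ℝ) / 2 with hμ
  set C₀ : ℝ := (ZLattice.covolume L)⁻¹ * Real.sqrt π ^ n with hC₀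
  have hσ0 : 0 < σ := by omega
  have hσ' : (0 : ℝ) < σ := by exact_mod_cast hσ0
  have hG : 0 < Real.Gamma σ := Real.Gamma_pos_of_pos hσ'
  have hcov : 0 < ZLattice.covolume L := ZLattice.covolume_pos L volume
  have hC₀pos : 0 < C₀ := by positivity
  have hμpos : 0 < μ := by
    simp only [hμ]
    have : (n : ℝ) < 2 * σ := by exact_mod_cast hσ
    linarith
  have hK : Summable fun w : dualLattice L =>
      (π * ‖(w : V)‖ / Real.sqrt c) ^ μ * besselKReal μ (2 * π * Real.sqrt c * ‖(w : V)‖) :=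
    summable_rpow_mul_besselKReal (dualLattice L) hμpos hc
  -- the Bessel summand `T w` and the weights `a w = 1 - cos 2π⟪x,w⟫`
  set T : dualLattice L → ℝ := fun w =>
    (π * ‖(w : V)‖ / Real.sqrt c) ^ μ * besselKReal μ (2 * π * Real.sqrt c * ‖(w : V)‖) with hT
  set a : dualLattice L → ℝ := fun w => 1 - Real.cos (2 * π * ⟪x, (w : V)⟫_ℝ) with ha
  have ha0 : ∀ w, 0 ≤ a w := fun w => by
    simp only [ha]; linarith [Real.cos_le_one (2 * π * ⟪x, (w : V)⟫_ℝ)]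
  have ha2 : ∀ w, a w ≤ 2 := fun w => by
    simp only [ha]; linarith [Real.neg_one_le_cos (2 * π * ⟪x, (w : V)⟫_ℝ)]
  have hT0 : ∀ w, 0 ≤ T w := by
    intro w
    by_cases hw : (w : V) = 0
    · have hμ0 : μ ≠ 0 := by
        simp only [hμ]
        have : (n : ℝ) < 2 * σ := by exact_mod_cast hσ
        linarith
      simp [hT, hw, Real.zero_rpow hμ0]
    · exact mul_nonneg (Real.rpow_nonneg (by positivity) _)
        (besselKReal_pos μ (by positivity [norm_pos_iff.2 hw])).le
  -- the dual core family and its integrals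
  set core : dualLattice L → ℝ → ℝ := fun w u =>
    u ^ (μ - 1) * Real.exp (-(c * u + π ^ 2 * ‖(w : V)‖ ^ 2 / u)) with hcore
  set q : dualLattice L → ℝ → ℝ := fun w u => C₀ * a w * core w u with hq
  have hq_int_val : ∀ w, (∫ u in Ioi (0 : ℝ), q w u) = 2 * C₀ * (a w * T w) ∧
      Integrable (q w) (volume.restrict (Ioi (0 : ℝ))) := by
    intro w
    by_cases hw : (w : V) = 0
    · have ha00 : a w = 0 := by simp [ha, hw]
      have hq0 : q w = fun _ => 0 := by funext u; simp [hq, ha00]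
      rw [hq0]
      exact ⟨by simp [ha00], integrable_zero _ _ _⟩
    · obtain ⟨hval, hint⟩ := integral_core_eq_besselKReal hc μ hw
      refine ⟨?_, (hint.integrable.const_mul (C₀ * a w)).congr ?_⟩
      · simp only [hq]
        rw [integral_const_mul]
        simp only [hcore] at hval ⊢
        rw [hval]
        simp only [hT]
        ring
      · exact Filter.Eventually.of_forall fun u => rfl
  have hq_nn : ∀ w, ∀ u ∈ Ioi (0 : ℝ), 0 ≤ q w u := fun w u hu => by
    have hu : 0 < u := hu
    simp only [hq, hcore]
    exact mul_nonneg (mul_nonneg hC₀pos.le (ha0 w)) (by positivity)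
  have hq_norm : ∀ w, (∫ u in Ioi (0 : ℝ), ‖q w u‖) = 2 * C₀ * (a w * T w) := fun w => by
    rw [← (hq_int_val w).1]
    exact setIntegral_congr_fun measurableSet_Ioi fun u hu => Real.norm_of_nonneg (hq_nn w u hu)
  have haT : Summable fun w => a w * T w :=
    (hK.mul_left 2).of_nonneg_of_le (fun w => mul_nonneg (ha0 w) (hT0 w))
      fun w => mul_le_mul_of_nonneg_right (ha2 w) (hT0 w)
  have hq_sum : Summable fun w => ∫ u in Ioi (0 : ℝ), ‖q w u‖ := by
    simp_rw [hq_norm]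
    exact haT.mul_left _
  -- the two subordinated integrals
  set A : ℝ → ℝ := fun u => u ^ ((σ : ℝ) - 1) * (Real.exp (-(c * u)) * thetaShift L u 0) with hA
  set B : ℝ → ℝ := fun u => u ^ ((σ : ℝ) - 1) * (Real.exp (-(c * u)) * thetaShift L u x) with hB
  have hF0 : ∑' y : L, ((‖(y : V)‖ ^ 2 + c) ^ σ)⁻¹ = (Real.Gamma σ)⁻¹ * ∫ u in Ioi (0 : ℝ), A u := by
    have h := tsum_inv_pow_eq_integral_thetaShift L σ hσ hc 0
    simp only [sub_zero] at h
    exact h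
  have hFx : ∑' y : L, ((‖(y : V) - x‖ ^ 2 + c) ^ σ)⁻¹ = (Real.Gamma σ)⁻¹ * ∫ u in Ioi (0 : ℝ), B u :=
    tsum_inv_pow_eq_integral_thetaShift L σ hσ hc x
  have hApos : 0 < ∑' y : L, ((‖(y : V)‖ ^ 2 + c) ^ σ)⁻¹ := by
    have h := tsum_inv_norm_sub_sq_add_pow_pos L σ hσ hc 0
    simp only [sub_zero] at h
    exact h
  have hAint : Integrable A (volume.restrict (Ioi (0 : ℝ))) := by
    refine Integrable.of_integral_ne_zero ?_
    intro h0
    rw [h0, mul_zero] at hF0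
    exact hApos.ne' hF0
  have hBint : Integrable B (volume.restrict (Ioi (0 : ℝ))) := by
    refine Integrable.of_integral_ne_zero ?_
    intro h0
    have hFx' := hFx
    rw [h0, mul_zero] at hFx'
    exact (tsum_inv_norm_sub_sq_add_pow_pos L σ hσ hc x).ne' hFx'
  -- pointwise on `u > 0`: A u - B u = Σ_w q w u
  have hpt : ∀ u ∈ Ioi (0 : ℝ), A u - B u = ∑' w, q w u := by
    intro u hu
    have hu : 0 < u := hu
    have hpow : u ^ ((σ : ℝ) - 1) * u ^ (-((n : ℝ) / 2)) = u ^ (μ - 1) := by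
      rw [← Real.rpow_add hu]
      congr 1
      simp only [hμ]
      ring
    have hstep : A u - B u = u ^ ((σ : ℝ) - 1) * Real.exp (-(c * u)) *
        (thetaShift L u 0 - thetaShift L u x) := by
      simp only [hA, hB]; ring
    rw [hstep, thetaShift_zero_sub_eq L hu x, sqrt_pi_div_pow hu n, ← tsum_mul_left,
      ← tsum_mul_left]
    refine tsum_congr fun w => ?_
    have hexp : Real.exp (-(c * u + π ^ 2 * ‖(w : V)‖ ^ 2 / u)) =
        Real.exp (-(c * u)) * Real.exp (-(π ^ 2 * ‖(w : V)‖ ^ 2 / u)) := by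
      rw [neg_add, Real.exp_add]
    simp only [hq, hcore, ha, hC₀, hexp, ← hpow]
    ring
  -- assemble
  have hdiff : (∫ u in Ioi (0 : ℝ), A u) - ∫ u in Ioi (0 : ℝ), B u =
      2 * C₀ * ∑' w, a w * T w := by
    rw [← integral_sub hAint hBint,
      setIntegral_congr_fun measurableSet_Ioi (fun u hu => hpt u hu),
      ← integral_tsum_of_summable_integral_norm (fun w => (hq_int_val w).2) hq_sum]
    simp_rw [(hq_int_val _).1]
    exact tsum_mul_left
  rw [hF0, hFx, ← mul_sub, hdiff]
  have hS : (∑' w, a w * T w) = ∑' w : dualLattice L, (1 - Real.cos (2 * π * ⟪x, (w : V)⟫_ℝ)) *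
      ((π * ‖(w : V)‖ / Real.sqrt c) ^ μ * besselKReal μ (2 * π * Real.sqrt c * ‖(w : V)‖)) := rfl
  rw [hS, hC₀]
  set S := ∑' w : dualLattice L, (1 - Real.cos (2 * π * ⟪x, (w : V)⟫_ℝ)) *
      ((π * ‖(w : V)‖ / Real.sqrt c) ^ μ * besselKReal μ (2 * π * Real.sqrt c * ‖(w : V)‖))
    with hSdef
  field_simp

/-- **Registry insensitivity of inverse-power layer sums** (the bound used by the far-core window
certificates): `0 ≤ F(0) − F(x) ≤ (4√πⁿ/(Γ(σ) covol L)) Σ_{w∈L*} (π‖w‖/√c)^μ K_μ(2π√c‖w‖)`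
(`μ = σ − n/2`; the `w = 0` term vanishes since `0^μ = 0`). [folklore] -/
theorem tsum_inv_pow_shift_spread_le (σ : ℕ) (hσ : finrank ℝ V < 2 * σ) {c : ℝ} (hc : 0 < c)
    (x : V) :
    0 ≤ (∑' y : L, ((‖(y : V)‖ ^ 2 + c) ^ σ)⁻¹) - ∑' y : L, ((‖(y : V) - x‖ ^ 2 + c) ^ σ)⁻¹ ∧
    (∑' y : L, ((‖(y : V)‖ ^ 2 + c) ^ σ)⁻¹) - ∑' y : L, ((‖(y : V) - x‖ ^ 2 + c) ^ σ)⁻¹ ≤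
      4 * Real.sqrt π ^ finrank ℝ V / (Real.Gamma σ * ZLattice.covolume L) *
        ∑' w : dualLattice L,
          (π * ‖(w : V)‖ / Real.sqrt c) ^ ((σ : ℝ) - finrank ℝ V / 2) *
            besselKReal ((σ : ℝ) - finrank ℝ V / 2) (2 * π * Real.sqrt c * ‖(w : V)‖) := by
  rw [tsum_inv_pow_sub_tsum_inv_pow_shift_eq L σ hσ hc x]
  have hμ : 0 < (σ : ℝ) - finrank ℝ V / 2 := by
    have : (finrank ℝ V : ℝ) < 2 * σ := by exact_mod_cast hσ
    linarith
  have hK := summable_rpow_mul_besselKReal (dualLattice L) hμ hc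
  have hσ0 : 0 < σ := by omega
  have hG : 0 < Real.Gamma σ := Real.Gamma_pos_of_pos (by exact_mod_cast hσ0)
  have hcov : 0 < ZLattice.covolume L := ZLattice.covolume_pos L volume
  have hK0 : 0 ≤ 2 * Real.sqrt π ^ finrank ℝ V / (Real.Gamma σ * ZLattice.covolume L) := by
    positivity
  have ha0 : ∀ w : dualLattice L, 0 ≤ 1 - Real.cos (2 * π * ⟪x, (w : V)⟫_ℝ) := fun w => by
    linarith [Real.cos_le_one (2 * π * ⟪x, (w : V)⟫_ℝ)]
  have ha2 : ∀ w : dualLattice L, 1 - Real.cos (2 * π * ⟪x, (w : V)⟫_ℝ) ≤ 2 := fun w => by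
    linarith [Real.neg_one_le_cos (2 * π * ⟪x, (w : V)⟫_ℝ)]
  have hT0 : ∀ w : dualLattice L, 0 ≤ (π * ‖(w : V)‖ / Real.sqrt c) ^ ((σ : ℝ) - finrank ℝ V / 2) *
      besselKReal ((σ : ℝ) - finrank ℝ V / 2) (2 * π * Real.sqrt c * ‖(w : V)‖) :=
    fun w => besselTerm_nonneg hμ hc (w : V)
  have hK2 : Summable fun w : dualLattice L =>
      2 * ((π * ‖(w : V)‖ / Real.sqrt c) ^ ((σ : ℝ) - finrank ℝ V / 2) *
        besselKReal ((σ : ℝ) - finrank ℝ V / 2) (2 * π * Real.sqrt c * ‖(w : V)‖)) :=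
    hK.mul_left 2
  have haT : Summable fun w : dualLattice L => (1 - Real.cos (2 * π * ⟪x, (w : V)⟫_ℝ)) *
      ((π * ‖(w : V)‖ / Real.sqrt c) ^ ((σ : ℝ) - finrank ℝ V / 2) *
        besselKReal ((σ : ℝ) - finrank ℝ V / 2) (2 * π * Real.sqrt c * ‖(w : V)‖)) :=
    hK2.of_nonneg_of_le (fun w => mul_nonneg (ha0 w) (hT0 w))
      fun w => mul_le_mul_of_nonneg_right (ha2 w) (hT0 w)
  refine ⟨mul_nonneg hK0 (tsum_nonneg fun w => mul_nonneg (ha0 w) (hT0 w)), ?_⟩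
  have hle : ∑' w : dualLattice L, (1 - Real.cos (2 * π * ⟪x, (w : V)⟫_ℝ)) *
      ((π * ‖(w : V)‖ / Real.sqrt c) ^ ((σ : ℝ) - finrank ℝ V / 2) *
        besselKReal ((σ : ℝ) - finrank ℝ V / 2) (2 * π * Real.sqrt c * ‖(w : V)‖)) ≤
      ∑' w : dualLattice L, 2 * ((π * ‖(w : V)‖ / Real.sqrt c) ^ ((σ : ℝ) - finrank ℝ V / 2) *
        besselKReal ((σ : ℝ) - finrank ℝ V / 2) (2 * π * Real.sqrt c * ‖(w : V)‖)) :=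
    haT.tsum_le_tsum (fun w => mul_le_mul_of_nonneg_right (ha2 w) (hT0 w)) hK2
  rw [tsum_mul_left] at hle
  refine le_of_le_of_eq (mul_le_mul_of_nonneg_left hle hK0) ?_
  have hKK : 2 * Real.sqrt π ^ finrank ℝ V / (Real.Gamma σ * ZLattice.covolume L) * 2 =
      4 * Real.sqrt π ^ finrank ℝ V / (Real.Gamma σ * ZLattice.covolume L) := by ring
  rw [← mul_assoc, hKK]

/-- Two-point form of the registry insensitivity: `|F(x) − F(x')| ≤ R` for any two shifts.
[this file] -/
theorem abs_tsum_inv_pow_shift_sub_le (σ : ℕ) (hσ : finrank ℝ V < 2 * σ) {c : ℝ} (hc : 0 < c)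
    (x x' : V) :
    |(∑' y : L, ((‖(y : V) - x‖ ^ 2 + c) ^ σ)⁻¹) - ∑' y : L, ((‖(y : V) - x'‖ ^ 2 + c) ^ σ)⁻¹| ≤
      4 * Real.sqrt π ^ finrank ℝ V / (Real.Gamma σ * ZLattice.covolume L) *
        ∑' w : dualLattice L,
          (π * ‖(w : V)‖ / Real.sqrt c) ^ ((σ : ℝ) - finrank ℝ V / 2) *
            besselKReal ((σ : ℝ) - finrank ℝ V / 2) (2 * π * Real.sqrt c * ‖(w : V)‖) := by
  obtain ⟨h0, h1⟩ := tsum_inv_pow_shift_spread_le L σ hσ hc x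
  obtain ⟨h0', h1'⟩ := tsum_inv_pow_shift_spread_le L σ hσ hc x'
  rw [abs_sub_le_iff]
  constructor <;> linarith

/-! ## §4 Layers in an ambient space: translates of a planar lattice

The consumer's form.  `W` is a subspace of an ambient inner product space `E` (the plane of a
layer), `Λ ⊂ W` a full lattice of `W` (the deformed in-plane lattice `B(ℤu + ℤv)`), and `p, p'`
two translates with `p − p' ∈ W` (two registries of the SAME layer: `p_o = o·Bw + kh·Be₃`) and
`p ∉ W` (the layer does not pass through the origin).  Then the inverse-power layer sums
`Σ_{y∈Λ} ‖y + p‖^{−2σ}` and `Σ_{y∈Λ} ‖y + p'‖^{−2σ}` differ by at most the Bessel sum of §3 with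
`c = dist(p, W)²` — Pythagoras `‖y + p‖² = ‖y + P p‖² + ‖p − P p‖²` (`P` = orthogonal projection
onto `W`) reduces to §3 inside `W`.  The measurable structure on `W` is a hypothesis (`borel`, supplied
by the consumer with `letI`). -/

section Ambient

variable {E : Type*} [NormedAddCommGroup E] [InnerProductSpace ℝ E] [FiniteDimensional ℝ E]

omit [FiniteDimensional ℝ E] in
/-- Pythagoras for a translate of a point of `W`: `‖y + p‖² = ‖y + Pp‖² + ‖p − Pp‖²`. [folklore] -/
theorem norm_sq_coe_add_eq (W : Submodule ℝ E) [W.HasOrthogonalProjection] (y : W) (p : E) :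
    ‖(y : E) + p‖ ^ 2 =
      ‖y + ⟨W.starProjection p, W.starProjection_apply_mem p⟩‖ ^ 2 + ‖p - W.starProjection p‖ ^ 2 := by
  have hsplit : (y : E) + p = ((y : E) + W.starProjection p) + (p - W.starProjection p) := by abel
  have horth : ⟪(y : E) + W.starProjection p, p - W.starProjection p⟫_ℝ = 0 :=
    W.inner_right_of_mem_orthogonal (add_mem y.2 (W.starProjection_apply_mem p))
      (W.sub_starProjection_mem_orthogonal p)
  have h := norm_add_sq_eq_norm_sq_add_norm_sq_real horth
  have hn : ‖y + ⟨W.starProjection p, W.starProjection_apply_mem p⟩‖ = ‖(y : E) + W.starProjection p‖ := by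
    rw [Submodule.coe_norm, Submodule.coe_add, Submodule.coe_mk]
  rw [hsplit, hn, sq, sq, sq]
  exact h

omit [FiniteDimensional ℝ E] in
/-- Two translates differing by a vector of `W` have the same normal part. [folklore] -/
theorem sub_starProjection_eq_of_sub_mem (W : Submodule ℝ E) [W.HasOrthogonalProjection] {p p' : E}
    (h : p - p' ∈ W) : p - W.starProjection p = p' - W.starProjection p' := by
  have h1 : W.starProjection (p - p') = p - p' := Submodule.starProjection_eq_self_iff.2 h
  rw [map_sub] at h1
  rw [sub_eq_sub_iff_sub_eq_sub]
  exact h1.symm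

/-- **Registry insensitivity of a layer sum, ambient form.** [this file] -/
theorem abs_tsum_inv_pow_translate_sub_le (W : Submodule ℝ E) [MeasurableSpace W] [BorelSpace W]
    (Λ : Submodule ℤ W) [DiscreteTopology Λ] [IsZLattice ℝ Λ]
    (σ : ℕ) (hσ : finrank ℝ W < 2 * σ) {p p' : E} (hpp' : p - p' ∈ W) (hp : p ∉ W) :
    |(∑' y : Λ, ((‖((y : W) : E) + p‖ ^ 2) ^ σ)⁻¹) - ∑' y : Λ, ((‖((y : W) : E) + p'‖ ^ 2) ^ σ)⁻¹| ≤
      4 * Real.sqrt π ^ finrank ℝ W / (Real.Gamma σ * ZLattice.covolume Λ) *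
        ∑' w : dualLattice Λ,
          (π * ‖(w : W)‖ / ‖p - W.starProjection p‖) ^ ((σ : ℝ) - finrank ℝ W / 2) *
            besselKReal ((σ : ℝ) - finrank ℝ W / 2)
              (2 * π * ‖p - W.starProjection p‖ * ‖(w : W)‖) := by
  set d : ℝ := ‖p - W.starProjection p‖ with hd
  have hd0 : 0 < d := by
    refine norm_pos_iff.2 (sub_ne_zero.2 fun h => hp ?_)
    rw [h]; exact W.starProjection_apply_mem p
  have hc : 0 < d ^ 2 := by positivity
  set x : W := ⟨W.starProjection p, W.starProjection_apply_mem p⟩ with hx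
  set x' : W := ⟨W.starProjection p', W.starProjection_apply_mem p'⟩ with hx'
  have hd' : ‖p' - W.starProjection p'‖ = d := by
    rw [hd, sub_starProjection_eq_of_sub_mem W hpp']
  have hF : ∀ y : Λ, ((‖((y : W) : E) + p‖ ^ 2) ^ σ)⁻¹ = ((‖(y : W) - (-x)‖ ^ 2 + d ^ 2) ^ σ)⁻¹ := by
    intro y
    rw [norm_sq_coe_add_eq W (y : W) p, sub_neg_eq_add]
  have hF' : ∀ y : Λ, ((‖((y : W) : E) + p'‖ ^ 2) ^ σ)⁻¹ = ((‖(y : W) - (-x')‖ ^ 2 + d ^ 2) ^ σ)⁻¹ := by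
    intro y
    rw [norm_sq_coe_add_eq W (y : W) p', hd', sub_neg_eq_add]
  simp_rw [hF, hF']
  have h := abs_tsum_inv_pow_shift_sub_le Λ σ hσ hc (-x) (-x')
  rwa [Real.sqrt_sq hd0.le] at h

omit [FiniteDimensional ℝ E] in
/-- **Re-indexing a two-generator lattice sum** by `ℤ × ℤ`: for linearly independent `u, v`,
`Σ_{(i,j)∈ℤ²} f(iu + jv) = Σ_{y ∈ ℤb₀ + ℤb₁} f(y)` with `b = Basis.span` of `(u, v)` in
`W = span ℝ {u, v}`. [folklore] -/
theorem tsum_int_pair_eq_tsum_span {u v : E} (huv : LinearIndependent ℝ ![u, v]) (f : E → ℝ) :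
    ∑' ij : ℤ × ℤ, f ((ij.1 : ℝ) • u + (ij.2 : ℝ) • v) =
      ∑' y : Submodule.span ℤ (Set.range (Basis.span huv)),
        f (((y : Submodule.span ℝ (Set.range ![u, v])) : E)) := by
  set b := Basis.span huv with hb
  set Λ : Submodule ℤ (Submodule.span ℝ (Set.range ![u, v])) := Submodule.span ℤ (Set.range b)
    with hΛ
  have hmem : ∀ ij : ℤ × ℤ, ij.1 • b 0 + ij.2 • b 1 ∈ Λ := fun ij =>
    add_mem (Submodule.smul_mem _ _ (Submodule.subset_span ⟨0, rfl⟩))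
      (Submodule.smul_mem _ _ (Submodule.subset_span ⟨1, rfl⟩))
  let φ : ℤ × ℤ → Λ := fun ij => ⟨ij.1 • b 0 + ij.2 • b 1, hmem ij⟩
  have hφ : Function.Bijective φ := by
    constructor
    · intro ij ij' h
      have h1 : ij.1 • b 0 + ij.2 • b 1 = ij'.1 • b 0 + ij'.2 • b 1 := congrArg Subtype.val h
      have h2 : ((ij.1 - ij'.1 : ℤ) : ℝ) • b 0 + ((ij.2 - ij'.2 : ℤ) : ℝ) • b 1 = 0 := by
        rw [Int.cast_smul_eq_zsmul, Int.cast_smul_eq_zsmul, sub_smul, sub_smul]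
        rw [← sub_eq_zero] at h1
        rw [← h1]; abel
      have hli := Fintype.linearIndependent_iff.1 b.linearIndependent
        ![((ij.1 - ij'.1 : ℤ) : ℝ), ((ij.2 - ij'.2 : ℤ) : ℝ)] (by simpa [Fin.sum_univ_two] using h2)
      have e0 := hli 0
      have e1 := hli 1
      simp only [Matrix.cons_val_zero, Matrix.cons_val_one, Int.cast_eq_zero,
        sub_eq_zero] at e0 e1
      exact Prod.ext e0 e1
    · intro y
      obtain ⟨c, hc⟩ := (Submodule.mem_span_range_iff_exists_fun ℤ).1 y.2
      refine ⟨(c 0, c 1), Subtype.ext ?_⟩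
      simp only [φ]
      rw [← hc, Fin.sum_univ_two]
  rw [← (Equiv.ofBijective φ hφ).tsum_eq]
  refine tsum_congr fun ij => ?_
  simp only [Equiv.ofBijective_apply, φ, Submodule.coe_add, Submodule.coe_smul_of_tower,
    ← Int.cast_smul_eq_zsmul ℝ, hb, Basis.span_apply, Matrix.cons_val_zero, Matrix.cons_val_one]

omit [FiniteDimensional ℝ E] in
/-- `span ℝ {u, v}` is `2`-dimensional for independent `u, v`. [folklore] -/
theorem finrank_span_pair {u v : E} (huv : LinearIndependent ℝ ![u, v]) :
    finrank ℝ (Submodule.span ℝ (Set.range ![u, v])) = 2 := by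
  rw [finrank_span_eq_card huv, Fintype.card_fin]

/-- **Registry insensitivity of a two-generator layer sum** (the form instantiated by the far-core
window certificates with `u = B t₁`, `v = B t₂`, `p_o = o·B w + k√(2/3)·B e₃`): for independent
`u, v`, shifts `p, p'` with `p − p' ∈ span{u,v} ∌ p`, and `σ ≥ 2`,
`|Σ_{(i,j)} ‖iu + jv + p‖^{−2σ} − Σ_{(i,j)} ‖iu + jv + p'‖^{−2σ}| ≤ (4π/(Γ(σ)·covol)) Σ_{w ∈ Λ*}
(π‖w‖/d)^{σ−1} K_{σ−1}(2π d‖w‖)`, `d = dist(p, span{u,v})`, `Λ = ℤu + ℤv`. [this file] -/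
theorem abs_tsum_int_pair_translate_sub_le {u v : E} (huv : LinearIndependent ℝ ![u, v])
    [MeasurableSpace (Submodule.span ℝ (Set.range ![u, v]))]
    [BorelSpace (Submodule.span ℝ (Set.range ![u, v]))]
    (σ : ℕ) (hσ : 1 < σ) {p p' : E} (hpp' : p - p' ∈ Submodule.span ℝ (Set.range ![u, v]))
    (hp : p ∉ Submodule.span ℝ (Set.range ![u, v])) :
    |(∑' ij : ℤ × ℤ, ((‖(ij.1 : ℝ) • u + (ij.2 : ℝ) • v + p‖ ^ 2) ^ σ)⁻¹) -
        ∑' ij : ℤ × ℤ, ((‖(ij.1 : ℝ) • u + (ij.2 : ℝ) • v + p'‖ ^ 2) ^ σ)⁻¹| ≤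
      4 * Real.sqrt π ^ 2 /
          (Real.Gamma σ * ZLattice.covolume (Submodule.span ℤ (Set.range (Basis.span huv)))) *
        ∑' w : dualLattice (Submodule.span ℤ (Set.range (Basis.span huv))),
          (π * ‖(w : Submodule.span ℝ (Set.range ![u, v]))‖ /
              ‖p - (Submodule.span ℝ (Set.range ![u, v])).starProjection p‖) ^ ((σ : ℝ) - 1) *
            besselKReal ((σ : ℝ) - 1)
              (2 * π * ‖p - (Submodule.span ℝ (Set.range ![u, v])).starProjection p‖ *
                ‖(w : Submodule.span ℝ (Set.range ![u, v]))‖) := by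
  rw [tsum_int_pair_eq_tsum_span huv (fun z => ((‖z + p‖ ^ 2) ^ σ)⁻¹),
    tsum_int_pair_eq_tsum_span huv (fun z => ((‖z + p'‖ ^ 2) ^ σ)⁻¹)]
  have hrank : finrank ℝ (Submodule.span ℝ (Set.range ![u, v])) = 2 := finrank_span_pair huv
  have hσ' : finrank ℝ (Submodule.span ℝ (Set.range ![u, v])) < 2 * σ := by rw [hrank]; omega
  have h := abs_tsum_inv_pow_translate_sub_le (Submodule.span ℝ (Set.range ![u, v]))
    (Submodule.span ℤ (Set.range (Basis.span huv))) σ hσ' hpp' hp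
  have hμ : ((σ : ℝ) - (finrank ℝ (Submodule.span ℝ (Set.range ![u, v])) : ℝ) / 2) = (σ : ℝ) - 1 := by
    rw [hrank]; norm_num
  rw [hμ, hrank] at h
  exact h

end Ambient

end Summit.AtomisticToContinuum.Crystallization.Theorems.OverbindingBudgetAffineFarSmoothSplit
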